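import Summits.QuantumFields.YangMills.Theorems.SwapVirialDeficitSectorLaplaceEndCoreSplit
import Summits.QuantumFields.YangMills.Theorems.SwapVirialDeficitSectorLaplaceBulkStiffness
import HarnessLib

/-!
# `stub_core_end` OF SKELETON ➎ FROM ONE MATCHED COMPARISON ON THE GAUSSIAN HALF — the end-core assembly
# (free-hands support of ⟨stmt-QuantumFields-24197⟩ `SwapVirialDeficit.SwapGluedStiffness`; LEAD g99, 2026-08-31 ≥ 22:10Z)

The end core `(EndHub τ ×ˢ univ) ∖ BTubeCap L τ 1` of skeleton ➎ (HOME `fcl-p3-g48-SectorStiffnessSkeleton.lean`, stub `stub_core_end`) is, per sign pattern and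
read on `chartMeasure L`, at most `coneConst·π·(∫_G e^{−bF̂(hubAt δ 1, ε, η)} dμ_B + e^{−b·c_end}·π·e^{|log(coneConst³/64)|+18L⁴})` with `G` the GAUSSIAN HALF
of the end window (✓`setIntegral_endCore_chart_le_gaussHalf_add_tail`).  This file discharges everything around the Gaussian half:
* §1 ★ `bulkHub_ge_half_main` — the bulk side ONCE: `½·(2π/b)^α·M_ε ≤ ∫_{HubBulk τ} I(·,ε;b) dcone` above the bulk threshold
  (`M_ε = ∫_{HubBulk τ}∫_{ℝ²}𝔪`, w2 g59 ✓`bulk_fibred_plane` ∘ ✓`bulk_relative_law` ∘ ✓`bulk_absorb` ∘ ✓`bulk_thresholds`);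
* §2 ★ `endTail_le_main` — the hub-shell tail is absorbed: `κ_L·coneConst·π·(e^{−X}·π·e^{…}) ≤ (1/128)·(2π/b)^α·M_ε` once `b^{1/4}(4(9L⁴+1) + M_T) ≤ X`
  (✓`exp_absorb`, ✓`bulkMass_exp_floor`; `coneConst ≤ e^{ℓ+21}`, `κ_L ≤ e^{9L⁴}`);
* §3 `endTail_threshold` — from `(840000·A)²·L³⁶·τ⁻¹³⁶ ≤ b`: `1 ≤ b` and `b^{1/4}·A·L⁸ ≤ b·c_end(τ,1)` (`c_end(τ,1) ≥ τ⁴/(840000L¹⁰)`);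
* §4 ★★★ `stub_core_end_of_gaussHalf (hG) : <stub_core_end VERBATIM>` — from ONE hypothesis, the MATCHED COMPARISON ON THE GAUSSIAN HALF per good `ε`:
  `κ_L·coneConst·π·∫_G e^{−bF̂(hubAt δ 1,ε,η)} dμ_B ≤ (1/128)·(2π/b)^α·M_ε` for `τ ≤ τ₀/L^k`, `b ≥ K·L^k·τ⁻¹^k` (the shape to register as `stub_end_gaussHalf`;
  its inputs: leader side w3 g67 ✓`lintegral_uFirst_le` ∕ ✓`lintegral_endSlab_le`, follower side w2 g60 ✓`follower_laplace_ceiling` + (T2) det matching, memo10b–e).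
  Budget: `1/128 + 1/128 = 1/64` of the main term `≤ 1/32` of the bulk integral.

HONEST LABEL: bookkeeping ∕ threshold arithmetic; `stub_core_end` is closed MODULO the Gaussian-half comparison `hG` (OPEN); stubs core-tip ∕ 001-good of ➎ OPEN;
⟨24197⟩ ∕ ⟨24194⟩ OPEN; own crux ⟨22884⟩ `LargeFieldMassRefinementTail` OPEN (blocked-on ⟨19935⟩); the Yang–Mills mass gap is NOT proved; no summit is proved by a line.
THEOREMS ONLY (0 `def`, 0 `sorry`), standard axioms; the series' local `ℍ` instances.  LEAD seat ym-line-sfw-p2 g99 (cell ym-idea-1, free hands),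
`--supports stmt-QuantumFields-24197`.  References: [cite: Luscher1983, §2]; [cite: Griffiths1964]; [folklore].
-/

set_option autoImplicit false
set_option synthInstance.maxSize 1024

noncomputable section

open MeasureTheory Quaternion Set
open scoped Quaternion BigOperators ENNReal
open Literature.MathematicalPhysics.QuantumLattice
open Literature.MathematicalPhysics.QuantumFieldTheory hiding SU2
open Summit.QuantumFields.YangMills.Theorems.SwapTwistDeficit.ToronLog

attribute [local instance] Literature.Analysis.FluidPDE.Tao2016.quatMeasurableSpace
  Literature.Analysis.FluidPDE.Tao2016.quatBorelSpace
  Literature.MathematicalPhysics.QuantumLattice.secondCountableTopology_su2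

namespace Summit.QuantumFields.YangMills.Theorems.SwapVirialDeficit.SectorLaplace

open Summit.QuantumFields.YangMills.Theorems.FemtoTransferGap
open Summit.QuantumFields.YangMills.Theorems.FemtoTransferGap.TT
open Summit.QuantumFields.YangMills.Theorems.VirialFluxGap.RingDeficit
open Summit.QuantumFields.YangMills.Theorems.SwapVirialDeficit.SwapRing
open Summit.QuantumFields.YangMills.Theorems.SwapVirialDeficit.BlowUpRing

variable {L : ℕ} [NeZero L]

/-! ## §1 The bulk side once: `½·(2π/b)^α·M_ε ≤ ∫_{HubBulk τ} I` -/

set_option maxHeartbeats 400000 in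
/-- ★ **THE BULK INTEGRAL DOMINATES HALF ITS MORSE–BOTT MAIN TERM** above the bulk threshold `P⁴ ≤ b` of ✓`bulk_thresholds` (per good `ε`, `0 < τ ≤ ½`):
`½·(2π/b)^α·∫_{HubBulk τ}∫_{ℝ²}𝔪_ε ≤ ∫_{HubBulk τ} I(·,ε;b) dcone` (✓`bulk_relative_law`: `|Z − main| ≤ r·main + (∫ρ)e^{−X}`; ✓`bulk_absorb`: `(∫ρ)e^{−X} ≤ b^{−1/4}·main`;
`r + b^{−1/4} ≤ 1/(20000L⁴) ≤ ½`). [cite: Luscher1983, §2] -/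
theorem bulkHub_ge_half_main {K₂ : ℝ} (hK₂ : 0 < K₂) {k₂ : ℕ}
    (hS2 : ∀ (ψ₀ b : ℝ), 0 < ψ₀ → ψ₀ ≤ 1 → (K₂ * (L : ℝ) ^ k₂ * (1 / ψ₀) ^ k₂) ^ 2 ≤ b → ∀ a : ℍ, a ∈ HubBulk ψ₀ → ∀ ε : GnoSign L, GoodSign ε →
      |(∫ η : GnoCoord L, Real.exp (-(b * gnoDeficit z₀ (fun _ => 1) a ε η)) * gnoDensity η) - (2 * Real.pi / b) ^ alpha L * ∫ p : ℝ × ℝ, mbDensity a ε p| ≤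
        K₂ * (L : ℝ) ^ k₂ * (1 / ψ₀) ^ k₂ * b ^ (-(1 / 2 : ℝ)) * ((2 * Real.pi / b) ^ alpha L * ∫ p : ℝ × ℝ, mbDensity a ε p) +
          (∫ η : GnoCoord L, gnoDensity η) * Real.exp (-(b * (ψ₀ / (K₂ * (L : ℝ) ^ k₂)) ^ k₂)))
    {ε : GnoSign L} (hε : GoodSign ε) {τ : ℝ} (hτ : 0 < τ) (hτ1 : τ ≤ 1 / 2) {b : ℝ}
    (hb : (40000 * (K₂ + 1) ^ (k₂ + 1) *
      ((|Real.log (coneMeasure.real (HubBulk (1 / 2)))| + |Real.log (coneConst ^ 3 / 64)| + 183620 * (L : ℝ) ^ 8) + 40) *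
        (L : ℝ) ^ (12 + k₂ + k₂ * k₂) * τ⁻¹ ^ k₂) ^ 4 ≤ b) :
    (1 / 2 : ℝ) * ((2 * Real.pi / b) ^ alpha L * ∫ a in HubBulk τ, (∫ p : ℝ × ℝ, mbDensity (L := L) a ε p) ∂coneMeasure) ≤
      ∫ a in HubBulk τ, hubIntegral a ε b ∂coneMeasure := by
  have hL1 : (1 : ℝ) ≤ L := by exact_mod_cast NeZero.one_le
  have hL4 : (1 : ℝ) ≤ (L : ℝ) ^ 4 := one_le_pow₀ hL1
  set A : ℝ := |Real.log (coneMeasure.real (HubBulk (1 / 2)))| + |Real.log (coneConst ^ 3 / 64)| + 183620 * (L : ℝ) ^ 8 with hAdef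
  have hA0 : 0 ≤ A := by positivity
  obtain ⟨hb1, hbii, hbiii, hbiv⟩ := bulk_thresholds (L := L) hK₂ hA0 hτ hτ1 hL1 hb
  have hb0 : 0 < b := by linarith
  set main : ℝ := (2 * Real.pi / b) ^ alpha L * ∫ a in HubBulk τ, (∫ p : ℝ × ℝ, mbDensity (L := L) a ε p) ∂coneMeasure with hmain
  have hmain0 : 0 ≤ main :=
    mul_nonneg (by positivity) (setIntegral_nonneg (measurableSet_hubBulk τ) fun a _ => integral_nonneg fun p => mbDensity_nonneg a ε p)
  have hrel := (abs_sub_le_iff.1 (bulk_relative_law hS2 hε hτ hτ1 hb0 hbii)).2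
  have habs := bulk_absorb (L := L) hε hτ hτ1 hb1 hbiii
  have hsmall : K₂ * (L : ℝ) ^ k₂ * (1 / τ) ^ k₂ * b ^ (-(1 / 2 : ℝ)) + b ^ (-(1 / 4 : ℝ)) ≤ 1 / 2 := hbiv.trans (by
    rw [div_le_iff₀ (by positivity)]; nlinarith)
  have hprod := mul_le_mul_of_nonneg_right hsmall hmain0
  rw [add_mul] at hprod
  rw [← hmain] at hrel habs
  linarith

/-! ## §2 The hub-shell tail is absorbed into the main term -/

/-- `coneConst ≤ e^{|log(coneConst³/64)| + 21}` (`3 log c = log(c³/64) + log 64`, `log 64 ≤ 63`). [folklore] -/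
theorem coneConst_le_exp : coneConst ≤ Real.exp (|Real.log (coneConst ^ 3 / 64)| + 21) := by
  have hc0 := coneConst_pos
  have h3 : 3 * Real.log coneConst = Real.log (coneConst ^ 3 / 64) + Real.log 64 := by
    rw [Real.log_div (pow_ne_zero 3 hc0.ne') (by norm_num), Real.log_pow]; push_cast; ring
  have h64 : Real.log 64 ≤ 63 := by have := Real.log_le_sub_one_of_pos (show (0 : ℝ) < 64 by norm_num); linarith
  have hlog : Real.log coneConst ≤ |Real.log (coneConst ^ 3 / 64)| + 21 := by
    have := le_abs_self (Real.log (coneConst ^ 3 / 64))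
    have h0 := abs_nonneg (Real.log (coneConst ^ 3 / 64))
    linarith
  calc coneConst = Real.exp (Real.log coneConst) := (Real.exp_log hc0).symm
    _ ≤ Real.exp (|Real.log (coneConst ^ 3 / 64)| + 21) := Real.exp_le_exp.2 hlog

/-- `0 < stiffKappa L (1/8) ≤ e^{9L⁴}`. [folklore] -/
theorem stiffKappa_pos_le_exp : 0 < stiffKappa L (1 / 8) ∧ stiffKappa L (1 / 8) ≤ Real.exp (9 * (L : ℝ) ^ 4) := by
  have hL1 : (1 : ℝ) ≤ L := by exact_mod_cast NeZero.one_le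
  have hL4 : (1 : ℝ) ≤ (L : ℝ) ^ 4 := one_le_pow₀ hL1
  have he := Real.add_one_le_exp (9 * (L : ℝ) ^ 4)
  unfold stiffKappa
  exact ⟨by linarith, by linarith⟩

set_option maxHeartbeats 400000 in
/-- ★ **THE HUB-SHELL TAIL IS ABSORBED**: per good `ε`, `0 < τ ≤ ½`, `b ≥ 1`, with `M_T = |log cone(HubBulk ½)| + 2|log(coneConst³/64)| + 154 + 183629·L⁸` and
`b^{1/4}·(4(9L⁴+1) + M_T) ≤ X`:  `κ_L·(coneConst·π·(e^{−X}·(π·e^{|log(coneConst³/64)|+18L⁴}))) ≤ (1/128)·(2π/b)^α·∫_{HubBulk τ}∫𝔪_ε`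
(✓`exp_absorb` with `𝔐 = M_ε/Q`, `Q = 128·κ_L·coneConst·π²·e^{…} ≤ e^{154 + 2ℓ + 27L⁸}`, `M_ε ≥ cone(HubBulk ½)·e^{−183602L⁸}` ✓`bulkMass_exp_floor`). [folklore] -/
theorem endTail_le_main {ε : GnoSign L} (hε : GoodSign ε) {τ : ℝ} (hτ : 0 < τ) (hτ1 : τ ≤ 1 / 2) {b X : ℝ} (hb1 : 1 ≤ b)
    (hX : b ^ (1 / 4 : ℝ) * (4 * (9 * (L : ℝ) ^ 4 + 1) +
      (|Real.log (coneMeasure.real (HubBulk (1 / 2)))| + 2 * |Real.log (coneConst ^ 3 / 64)| + 154 + 183629 * (L : ℝ) ^ 8)) ≤ X) :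
    stiffKappa L (1 / 8) * (coneConst * Real.pi * (Real.exp (-X) * (Real.pi * Real.exp (|Real.log (coneConst ^ 3 / 64)| + 18 * (L : ℝ) ^ 4)))) ≤
      (1 / 128 : ℝ) * ((2 * Real.pi / b) ^ alpha L * ∫ a in HubBulk τ, (∫ p : ℝ × ℝ, mbDensity (L := L) a ε p) ∂coneMeasure) := by
  have hL1 : (1 : ℝ) ≤ L := by exact_mod_cast NeZero.one_le
  have hL4 : (1 : ℝ) ≤ (L : ℝ) ^ 4 := one_le_pow₀ hL1
  have hL8 : (L : ℝ) ^ 4 ≤ (L : ℝ) ^ 8 := pow_le_pow_right₀ hL1 (by norm_num)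
  set ℓ : ℝ := |Real.log (coneConst ^ 3 / 64)| with hℓ
  set cH : ℝ := coneMeasure.real (HubBulk (1 / 2)) with hcH
  have hcH0 : 0 < cH := coneMeasure_hubBulk_half_pos
  set M : ℝ := ∫ a in HubBulk τ, (∫ p : ℝ × ℝ, mbDensity (L := L) a ε p) ∂coneMeasure with hMdef
  have hM_lo : cH * Real.exp (-(183602 * (L : ℝ) ^ 8)) ≤ M := bulkMass_exp_floor hε hτ hτ1
  set κ : ℝ := stiffKappa L (1 / 8) with hκdef
  obtain ⟨hκ0, hκle⟩ := stiffKappa_pos_le_exp (L := L)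
  have hc0 := coneConst_pos
  have hcle : coneConst ≤ Real.exp (ℓ + 21) := coneConst_le_exp
  have hπle : Real.pi ≤ Real.exp 3 := Real.pi_le_four.trans (by have := Real.add_one_le_exp (3 : ℝ); linarith)
  have h128 : (128 : ℝ) ≤ Real.exp 127 := by have := Real.add_one_le_exp (127 : ℝ); linarith
  -- the prefactor `Q`
  set Q : ℝ := 128 * κ * coneConst * Real.pi * Real.pi * Real.exp (ℓ + 18 * (L : ℝ) ^ 4) with hQ
  have hQ0 : 0 < Q :=
    mul_pos (mul_pos (mul_pos (mul_pos (mul_pos (by norm_num) hκ0) hc0) Real.pi_pos) Real.pi_pos) (Real.exp_pos _)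
  have hQle : Q ≤ Real.exp (154 + 2 * ℓ + 27 * (L : ℝ) ^ 8) := by
    have e : Real.exp (154 + 2 * ℓ + 27 * (L : ℝ) ^ 8) =
        Real.exp 127 * Real.exp (9 * (L : ℝ) ^ 4) * Real.exp (ℓ + 21) * Real.exp 3 * Real.exp 3 * Real.exp (ℓ + 18 * (L : ℝ) ^ 4) *
          Real.exp (27 * ((L : ℝ) ^ 8 - (L : ℝ) ^ 4)) := by
      simp only [← Real.exp_add]; congr 1; ring
    rw [e, hQ]
    have h7 : (1 : ℝ) ≤ Real.exp (27 * ((L : ℝ) ^ 8 - (L : ℝ) ^ 4)) := Real.one_le_exp (by nlinarith)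
    have s1 : 128 * κ ≤ Real.exp 127 * Real.exp (9 * (L : ℝ) ^ 4) := mul_le_mul h128 hκle hκ0.le (Real.exp_pos _).le
    have s2 : 128 * κ * coneConst ≤ Real.exp 127 * Real.exp (9 * (L : ℝ) ^ 4) * Real.exp (ℓ + 21) :=
      mul_le_mul s1 hcle hc0.le (by positivity)
    have s3 : 128 * κ * coneConst * Real.pi ≤ Real.exp 127 * Real.exp (9 * (L : ℝ) ^ 4) * Real.exp (ℓ + 21) * Real.exp 3 :=
      mul_le_mul s2 hπle Real.pi_pos.le (by positivity)
    have s4 : 128 * κ * coneConst * Real.pi * Real.pi ≤ Real.exp 127 * Real.exp (9 * (L : ℝ) ^ 4) * Real.exp (ℓ + 21) * Real.exp 3 * Real.exp 3 :=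
      mul_le_mul s3 hπle Real.pi_pos.le (by positivity)
    have s5 : 128 * κ * coneConst * Real.pi * Real.pi * Real.exp (ℓ + 18 * (L : ℝ) ^ 4) ≤
        Real.exp 127 * Real.exp (9 * (L : ℝ) ^ 4) * Real.exp (ℓ + 21) * Real.exp 3 * Real.exp 3 * Real.exp (ℓ + 18 * (L : ℝ) ^ 4) :=
      mul_le_mul_of_nonneg_right s4 (Real.exp_pos _).le
    calc 128 * κ * coneConst * Real.pi * Real.pi * Real.exp (ℓ + 18 * (L : ℝ) ^ 4)
        = 128 * κ * coneConst * Real.pi * Real.pi * Real.exp (ℓ + 18 * (L : ℝ) ^ 4) * 1 := (mul_one _).symm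
      _ ≤ Real.exp 127 * Real.exp (9 * (L : ℝ) ^ 4) * Real.exp (ℓ + 21) * Real.exp 3 * Real.exp 3 * Real.exp (ℓ + 18 * (L : ℝ) ^ 4) *
          Real.exp (27 * ((L : ℝ) ^ 8 - (L : ℝ) ^ 4)) := mul_le_mul s5 h7 zero_le_one (by positivity)
  -- the floor `M/Q ≥ e^{−M_T}`
  set MT : ℝ := |Real.log cH| + 2 * ℓ + 154 + 183629 * (L : ℝ) ^ 8 with hMT
  have hMT0 : 0 ≤ MT := by positivity
  have hfloor : Real.exp (-MT) ≤ M / Q := by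
    rw [le_div_iff₀ hQ0]
    have hcH' : Real.exp (-|Real.log cH|) ≤ cH := by
      calc Real.exp (-|Real.log cH|) ≤ Real.exp (Real.log cH) := Real.exp_le_exp.2 (neg_abs_le _)
        _ = cH := Real.exp_log hcH0
    calc Real.exp (-MT) * Q ≤ Real.exp (-MT) * Real.exp (154 + 2 * ℓ + 27 * (L : ℝ) ^ 8) :=
          mul_le_mul_of_nonneg_left hQle (Real.exp_pos _).le
      _ = Real.exp (-|Real.log cH|) * Real.exp (-(183602 * (L : ℝ) ^ 8)) := by
          rw [← Real.exp_add, ← Real.exp_add, hMT]; congr 1; ring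
      _ ≤ cH * Real.exp (-(183602 * (L : ℝ) ^ 8)) := mul_le_mul_of_nonneg_right hcH' (Real.exp_pos _).le
      _ ≤ M := hM_lo
  -- `exp_absorb`
  have he0 : (0 : ℝ) ≤ alpha L := by
    rw [show alpha L = 9 * (L : ℝ) ^ 4 - 1 from by unfold alpha; exact finrank_gnoFibre_real_div_two]; linarith
  have heE : alpha L ≤ 9 * (L : ℝ) ^ 4 := by
    rw [show alpha L = 9 * (L : ℝ) ^ 4 - 1 from by unfold alpha; exact finrank_gnoFibre_real_div_two]; linarith
  have hX' : b ^ (1 / 4 : ℝ) * (4 * (9 * (L : ℝ) ^ 4 + 1) + MT) ≤ X := by rw [hMT]; exact hX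
  have habs := exp_absorb (𝔐 := M / Q) hb1 he0 heE hMT0 hfloor hX'
  have hb0 : 0 < b := by linarith
  have hbq : b ^ (-(1 / 4 : ℝ)) ≤ 1 := Real.rpow_le_one_of_one_le_of_nonpos hb1 (by norm_num)
  have hmain0 : 0 ≤ (2 * Real.pi / b) ^ alpha L * (M / Q) :=
    mul_nonneg (by positivity) (div_nonneg ((mul_pos hcH0 (Real.exp_pos _)).le.trans hM_lo) hQ0.le)
  have hexp : Real.exp (-X) ≤ (2 * Real.pi / b) ^ alpha L * (M / Q) := by
    calc Real.exp (-X) ≤ b ^ (-(1 / 4 : ℝ)) * ((2 * Real.pi / b) ^ alpha L * (M / Q)) := habs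
      _ ≤ 1 * ((2 * Real.pi / b) ^ alpha L * (M / Q)) := mul_le_mul_of_nonneg_right hbq hmain0
      _ = _ := one_mul _
  -- conclude
  have eL : κ * (coneConst * Real.pi * (Real.exp (-X) * (Real.pi * Real.exp (ℓ + 18 * (L : ℝ) ^ 4)))) = Q / 128 * Real.exp (-X) := by
    rw [hQ]; ring
  rw [eL]
  calc Q / 128 * Real.exp (-X) ≤ Q / 128 * ((2 * Real.pi / b) ^ alpha L * (M / Q)) := mul_le_mul_of_nonneg_left hexp (div_nonneg hQ0.le (by norm_num))
    _ = (1 / 128 : ℝ) * ((2 * Real.pi / b) ^ alpha L * M) := by field_simp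

/-! ## §3 The tail threshold -/

omit [NeZero L] in
/-- `4(9L⁴+1) + M_T ≤ (|log cone(HubBulk ½)| + 2|log(coneConst³/64)| + 154 + 183669)·L⁸`. [folklore] -/
theorem endTail_const_le (hL1 : (1 : ℝ) ≤ L) :
    4 * (9 * (L : ℝ) ^ 4 + 1) + (|Real.log (coneMeasure.real (HubBulk (1 / 2)))| + 2 * |Real.log (coneConst ^ 3 / 64)| + 154 + 183629 * (L : ℝ) ^ 8) ≤
      (|Real.log (coneMeasure.real (HubBulk (1 / 2)))| + 2 * |Real.log (coneConst ^ 3 / 64)| + 154 + 183669) * (L : ℝ) ^ 8 := by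
  have hL8 : (1 : ℝ) ≤ (L : ℝ) ^ 8 := one_le_pow₀ hL1
  have hL48 : (L : ℝ) ^ 4 ≤ (L : ℝ) ^ 8 := pow_le_pow_right₀ hL1 (by norm_num)
  have h1 := mul_nonneg (abs_nonneg (Real.log (coneMeasure.real (HubBulk (1 / 2))))) (sub_nonneg.2 hL8)
  have h2 := mul_nonneg (abs_nonneg (Real.log (coneConst ^ 3 / 64))) (sub_nonneg.2 hL8)
  nlinarith [abs_nonneg (Real.log (coneMeasure.real (HubBulk (1 / 2)))), abs_nonneg (Real.log (coneConst ^ 3 / 64))]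

/-- The tail rate at cap `X₁ = 1` is at least `τ⁴/(840000·L¹⁰)` (`1+τ² ≤ 2`, `(1+1²)² = 4`, `1+|Fol L| ≤ 7L⁴` by ✓`card_fol_real_le`). [folklore] -/
theorem cEnd_one_ge {τ : ℝ} (hτ0 : 0 ≤ τ) (hτ1 : τ ≤ 1 / 2) :
    τ ^ 4 / (840000 * (L : ℝ) ^ 10) ≤
      τ ^ 4 / ((1 + τ ^ 2) * (1 + (1 : ℝ) ^ 2) ^ 2 * (15000 * (1 + (Fintype.card (Fol L) : ℝ)) * (L : ℝ) ^ 6)) := by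
  have hL1 : (1 : ℝ) ≤ L := by exact_mod_cast NeZero.one_le
  have hL0 : (0 : ℝ) < L := by linarith
  have hL4 : (1 : ℝ) ≤ (L : ℝ) ^ 4 := one_le_pow₀ hL1
  have hcard := card_fol_real_le (L := L)
  have hpos : 0 < (1 + τ ^ 2) * (1 + (1 : ℝ) ^ 2) ^ 2 * (15000 * (1 + (Fintype.card (Fol L) : ℝ)) * (L : ℝ) ^ 6) := by positivity
  refine div_le_div_of_nonneg_left (by positivity) hpos ?_
  have hτ2 : τ ^ 2 ≤ 1 := by nlinarith
  have h1 : (1 + τ ^ 2) * (1 + (1 : ℝ) ^ 2) ^ 2 ≤ 8 := by nlinarith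
  have h2 : 15000 * (1 + (Fintype.card (Fol L) : ℝ)) * (L : ℝ) ^ 6 ≤ 105000 * (L : ℝ) ^ 10 := by
    have h3 : 1 + (Fintype.card (Fol L) : ℝ) ≤ 7 * (L : ℝ) ^ 4 := by linarith
    have h4 : 0 ≤ (L : ℝ) ^ 6 := by positivity
    nlinarith [mul_le_mul_of_nonneg_right h3 h4]
  calc (1 + τ ^ 2) * (1 + (1 : ℝ) ^ 2) ^ 2 * (15000 * (1 + (Fintype.card (Fol L) : ℝ)) * (L : ℝ) ^ 6)
      ≤ 8 * (105000 * (L : ℝ) ^ 10) := mul_le_mul h1 h2 (by positivity) (by norm_num)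
    _ = 840000 * (L : ℝ) ^ 10 := by ring

set_option maxHeartbeats 400000 in
/-- ★ **THE TAIL THRESHOLD**: for `0 < τ ≤ ½`, `40 ≤ A` and `(840000·A)²·L³⁶·τ⁻¹³⁶ ≤ b`: `1 ≤ b` and `b^{1/4}·(A·L⁸) ≤ b·c_end(τ,1)`
(`b ≥ Y²`, `Y = 840000·A·L¹⁸·τ⁻⁴ ≥ 1` ⟹ `b^{3/4} ≥ Y^{3/2} ≥ Y`, and `Y·τ⁴/(840000L¹⁰) = A·L⁸`). [folklore] -/
theorem endTail_threshold {τ : ℝ} (hτ : 0 < τ) (hτ1 : τ ≤ 1 / 2) {A b : ℝ} (hA : 40 ≤ A)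
    (hb : (840000 * A) ^ 2 * (L : ℝ) ^ 36 * τ⁻¹ ^ 36 ≤ b) :
    1 ≤ b ∧ b ^ (1 / 4 : ℝ) * (A * (L : ℝ) ^ 8) ≤
      b * (τ ^ 4 / ((1 + τ ^ 2) * (1 + (1 : ℝ) ^ 2) ^ 2 * (15000 * (1 + (Fintype.card (Fol L) : ℝ)) * (L : ℝ) ^ 6))) := by
  have hL1 : (1 : ℝ) ≤ L := by exact_mod_cast NeZero.one_le
  have hL0 : (0 : ℝ) < L := by linarith
  have hτi1 : 1 ≤ τ⁻¹ := by rw [one_le_inv₀ hτ]; linarith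
  have hA0 : 0 < A := by linarith
  set Y : ℝ := 840000 * A * (L : ℝ) ^ 18 * τ⁻¹ ^ 4 with hY
  have hY1 : 1 ≤ Y := by
    have h1 : (1 : ℝ) ≤ (L : ℝ) ^ 18 := one_le_pow₀ hL1
    have h2 : (1 : ℝ) ≤ τ⁻¹ ^ 4 := one_le_pow₀ hτi1
    have h3 : (1 : ℝ) ≤ 840000 * A := by linarith
    calc (1 : ℝ) = 1 * 1 * 1 := by ring
      _ ≤ 840000 * A * (L : ℝ) ^ 18 * τ⁻¹ ^ 4 := mul_le_mul (mul_le_mul h3 h1 zero_le_one (by positivity)) h2 zero_le_one (by positivity)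
  have hY0 : 0 ≤ Y := by linarith
  have hY2b : Y ^ 2 ≤ b := by
    refine le_trans ?_ hb
    have e : Y ^ 2 = (840000 * A) ^ 2 * (L : ℝ) ^ 36 * τ⁻¹ ^ 8 := by rw [hY]; ring
    rw [e]
    exact mul_le_mul_of_nonneg_left (pow_le_pow_right₀ hτi1 (by norm_num)) (by positivity)
  have hb1 : 1 ≤ b := le_trans (by nlinarith) hY2b
  have hb0 : 0 < b := by linarith
  refine ⟨hb1, ?_⟩
  -- `b^{3/4} ≥ Y`
  have h34 : Y ≤ b ^ (3 / 4 : ℝ) := by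
    have h1 : (Y ^ 2) ^ (3 / 4 : ℝ) ≤ b ^ (3 / 4 : ℝ) := Real.rpow_le_rpow (by positivity) hY2b (by norm_num)
    have h2 : (Y ^ 2) ^ (3 / 4 : ℝ) = Y ^ (3 / 2 : ℝ) := by
      rw [← Real.rpow_natCast Y 2, ← Real.rpow_mul hY0]; norm_num
    have h3 : Y ^ (1 : ℝ) ≤ Y ^ (3 / 2 : ℝ) := Real.rpow_le_rpow_of_exponent_le hY1 (by norm_num)
    rw [Real.rpow_one] at h3
    linarith [h2.symm.le]
  -- `b = b^{1/4}·b^{3/4}`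
  have hsplit : b = b ^ (1 / 4 : ℝ) * b ^ (3 / 4 : ℝ) := by
    rw [← Real.rpow_add hb0]; norm_num
  have hq0 : 0 ≤ b ^ (1 / 4 : ℝ) := Real.rpow_nonneg hb0.le _
  have hc := cEnd_one_ge (L := L) hτ.le hτ1
  -- `A·L⁸ ≤ b^{3/4}·c_end`
  have hkey : A * (L : ℝ) ^ 8 ≤ b ^ (3 / 4 : ℝ) * (τ ^ 4 / ((1 + τ ^ 2) * (1 + (1 : ℝ) ^ 2) ^ 2 * (15000 * (1 + (Fintype.card (Fol L) : ℝ)) * (L : ℝ) ^ 6))) := by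
    have hτne : τ ≠ 0 := hτ.ne'
    have hLne : (L : ℝ) ≠ 0 := hL0.ne'
    have e : A * (L : ℝ) ^ 8 = Y * (τ ^ 4 / (840000 * (L : ℝ) ^ 10)) := by
      rw [hY]; field_simp
    rw [e]
    exact mul_le_mul h34 hc (by positivity) (Real.rpow_nonneg hb0.le _)
  calc b ^ (1 / 4 : ℝ) * (A * (L : ℝ) ^ 8)
      ≤ b ^ (1 / 4 : ℝ) * (b ^ (3 / 4 : ℝ) * (τ ^ 4 / ((1 + τ ^ 2) * (1 + (1 : ℝ) ^ 2) ^ 2 * (15000 * (1 + (Fintype.card (Fol L) : ℝ)) * (L : ℝ) ^ 6)))) :=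
        mul_le_mul_of_nonneg_left hkey hq0
    _ = b * (τ ^ 4 / ((1 + τ ^ 2) * (1 + (1 : ℝ) ^ 2) ^ 2 * (15000 * (1 + (Fintype.card (Fol L) : ℝ)) * (L : ℝ) ^ 6))) := by
        rw [← mul_assoc, ← hsplit]

/-! ## §4 ★★★ `stub_core_end` from the matched comparison on the Gaussian half -/

set_option maxHeartbeats 800000 in
/-- ★★★ **`stub_core_end` OF SKELETON ➎ (HOME `fcl-p3-g48-SectorStiffnessSkeleton.lean`, v8 = v9 = v10 statement) VERBATIM, FROM ONE HYPOTHESIS `hG` — THE MATCHED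
COMPARISON ON THE GAUSSIAN HALF**: if for every `L`, every cut `0 < τ ≤ τ₀/L^k`, every `b ≥ K·L^k·τ⁻¹^k` and every good sign pattern `ε`
`κ_L·coneConst·π·∫_G e^{−bF̂(hubAt δ 1, ε, η)} dμ_B ≤ (1/128)·(2π/b)^α·∫_{HubBulk τ}∫_{ℝ²}𝔪_ε` (`G = {end window} ∩ {|u|² ≤ 1 + x₀²}`), then the END core
`(EndHub τ ×ˢ univ) ∖ BTubeCap L τ 1` weighs at most `1/32` of the good bulk mass above a merged threshold (✓`setIntegral_endCore_chart_le_gaussHalf_add_tail`,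
`endTail_le_main`, `bulkHub_ge_half_main`; budget `1/128 + 1/128 = 1/64 ≤ ½·(1/32)`). [cite: Luscher1983, §2] [cite: Griffiths1964] -/
theorem stub_core_end_of_gaussHalf
    (hG : ∃ K : ℝ, 0 < K ∧ ∃ k : ℕ, ∃ τ₀ : ℝ, 0 < τ₀ ∧ τ₀ ≤ 1 / 2 ∧ ∀ (L : ℕ) [NeZero L] (τ : ℝ), 0 < τ → τ ≤ τ₀ / (L : ℝ) ^ k →
      ∀ b : ℝ, K * (L : ℝ) ^ k * τ⁻¹ ^ k ≤ b → ∀ ε : GnoSign L, GoodSign ε →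
        stiffKappa L (1 / 8) * (coneConst * Real.pi *
          ∫ p in {p : ℝ × GnoCoord L | 4 * p.1 ^ 2 / (1 + p.1 ^ 2) ^ 2 < τ ∧ τ ≤ (1 + p.1 ^ 2)⁻¹} ∩
                {p : ℝ × GnoCoord L | p.2.1.1 1 ^ 2 + p.2.1.1 2 ^ 2 ≤ 1 + p.2.1.1 0 ^ 2},
              Real.exp (-(b * gnoDeficit z₀ (fun _ => 1) (hubAt p.1 1) ε p.2))
              ∂((volume : Measure (ℝ × GnoCoord L)).withDensity fun p => ENNReal.ofReal (((1 + p.1 ^ 2)⁻¹) ^ 2 * gnoDensity p.2))) ≤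
          (1 / 128 : ℝ) * ((2 * Real.pi / b) ^ alpha L * ∫ a in HubBulk τ, (∫ p : ℝ × ℝ, mbDensity a ε p) ∂coneMeasure)) :
    ∃ K : ℝ, 0 < K ∧ ∃ k : ℕ, ∃ τ₀ : ℝ, 0 < τ₀ ∧ τ₀ ≤ 1 / 2 ∧ ∀ (L : ℕ) [NeZero L] (τ : ℝ), 0 < τ → τ ≤ τ₀ / (L : ℝ) ^ k →
      ∀ b : ℝ, K * (L : ℝ) ^ k * τ⁻¹ ^ k ≤ b →
        stiffKappa L (1 / 8) * ∑ ε ∈ (Finset.univ.filter fun ε : GnoSign L => GoodSign ε),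
            ∫ x in (EndHub τ ×ˢ (univ : Set (GnoCoord L))) \ BTubeCap L τ 1, Real.exp (-(b * gnoDeficit z₀ (fun _ => 1) x.1 ε x.2)) ∂chartMeasure L ≤
          (1 / 32 : ℝ) * ∑ ε ∈ (Finset.univ.filter fun ε : GnoSign L => GoodSign ε), ∫ a in HubBulk τ, hubIntegral a ε b ∂coneMeasure := by
  obtain ⟨K₂, hK₂, k₂, hS2⟩ := bulk_fibred_plane
  obtain ⟨KG, hKG, kG, τG, hτG, hτGh, hGf⟩ := hG
  -- the absolute constants
  set A₀ : ℝ := |Real.log (coneMeasure.real (HubBulk (1 / 2)))| + |Real.log (coneConst ^ 3 / 64)| with hA₀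
  set D₀ : ℝ := 40000 * (K₂ + 1) ^ (k₂ + 1) * (A₀ + 183620 + 40) with hD₀
  set dB : ℕ := 20 + k₂ + k₂ * k₂ with hdB
  set AT : ℝ := |Real.log (coneMeasure.real (HubBulk (1 / 2)))| + 2 * |Real.log (coneConst ^ 3 / 64)| + 154 + 183669 with hAT
  set KT : ℝ := (840000 * AT) ^ 2 with hKT
  have hD₀0 : 0 < D₀ := by rw [hD₀, hA₀]; positivity
  have hAT40 : 40 ≤ AT := by
    rw [hAT]
    have h1 := abs_nonneg (Real.log (coneMeasure.real (HubBulk (1 / 2))))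
    have h2 := abs_nonneg (Real.log (coneConst ^ 3 / 64))
    linarith
  have hKT0 : 0 < KT := by rw [hKT]; exact pow_pos (mul_pos (by norm_num) (by linarith)) 2
  have hKsum0 : 0 < KG + D₀ ^ 4 + KT := add_pos_of_pos_of_nonneg (add_pos_of_pos_of_nonneg hKG (pow_nonneg hD₀0.le 4)) hKT0.le
  refine ⟨KG + D₀ ^ 4 + KT, hKsum0, kG + 4 * dB + 36, τG, hτG, hτGh, fun L _ τ hτ hτle b hb => ?_⟩
  have hL1 : (1 : ℝ) ≤ L := by exact_mod_cast NeZero.one_le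
  have hL0 : (0 : ℝ) < L := by linarith
  set k : ℕ := kG + 4 * dB + 36 with hk
  have hLk : (1 : ℝ) ≤ (L : ℝ) ^ k := one_le_pow₀ hL1
  have hτ1 : τ ≤ 1 / 2 := hτle.trans ((div_le_self hτG.le hLk).trans hτGh)
  have hτi1 : 1 ≤ τ⁻¹ := by rw [one_le_inv₀ hτ]; linarith
  have hτleG : τ ≤ τG / (L : ℝ) ^ kG :=
    hτle.trans (div_le_div₀ hτG.le le_rfl (by positivity) (pow_le_pow_right₀ hL1 (by omega)))
  -- the three thresholds
  have hmono : ∀ {K' : ℝ} {k' : ℕ}, 0 < K' → K' ≤ KG + D₀ ^ 4 + KT → k' ≤ k → K' * (L : ℝ) ^ k' * τ⁻¹ ^ k' ≤ b := by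
    intro K' k' hK' hK'le hk'
    have h1 : τ⁻¹ ^ k' ≤ τ⁻¹ ^ k := pow_le_pow_right₀ hτi1 hk'
    have h3 : (L : ℝ) ^ k' ≤ (L : ℝ) ^ k := pow_le_pow_right₀ hL1 hk'
    calc K' * (L : ℝ) ^ k' * τ⁻¹ ^ k' ≤ (KG + D₀ ^ 4 + KT) * (L : ℝ) ^ k * τ⁻¹ ^ k :=
          mul_le_mul (mul_le_mul hK'le h3 (by positivity) hKsum0.le) h1 (by positivity) (mul_nonneg hKsum0.le (by positivity))
      _ ≤ b := hb
  have hD4 : 0 < D₀ ^ 4 := pow_pos hD₀0 4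
  have hbG : KG * (L : ℝ) ^ kG * τ⁻¹ ^ kG ≤ b := hmono hKG (by linarith) (by omega)
  have hbT : KT * (L : ℝ) ^ 36 * τ⁻¹ ^ 36 ≤ b := hmono hKT0 (by linarith) (by omega)
  have hbB' : D₀ ^ 4 * (L : ℝ) ^ (4 * dB) * τ⁻¹ ^ (4 * dB) ≤ b := hmono hD4 (by linarith) (by omega)
  have hbB : (40000 * (K₂ + 1) ^ (k₂ + 1) *
      ((|Real.log (coneMeasure.real (HubBulk (1 / 2)))| + |Real.log (coneConst ^ 3 / 64)| + 183620 * (L : ℝ) ^ 8) + 40) *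
        (L : ℝ) ^ (12 + k₂ + k₂ * k₂) * τ⁻¹ ^ k₂) ^ 4 ≤ b := by
    refine le_trans ?_ hbB'
    have h1 : 40000 * (K₂ + 1) ^ (k₂ + 1) *
        ((|Real.log (coneMeasure.real (HubBulk (1 / 2)))| + |Real.log (coneConst ^ 3 / 64)| + 183620 * (L : ℝ) ^ 8) + 40) *
          (L : ℝ) ^ (12 + k₂ + k₂ * k₂) * τ⁻¹ ^ k₂ ≤ D₀ * (L : ℝ) ^ dB * τ⁻¹ ^ dB := by
      have hL8 : (1 : ℝ) ≤ (L : ℝ) ^ 8 := one_le_pow₀ hL1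
      have hin : (|Real.log (coneMeasure.real (HubBulk (1 / 2)))| + |Real.log (coneConst ^ 3 / 64)| + 183620 * (L : ℝ) ^ 8) + 40 ≤
          (A₀ + 183620 + 40) * (L : ℝ) ^ 8 := by
        rw [hA₀]; nlinarith [abs_nonneg (Real.log (coneMeasure.real (HubBulk (1 / 2)))), abs_nonneg (Real.log (coneConst ^ 3 / 64))]
      calc 40000 * (K₂ + 1) ^ (k₂ + 1) *
            ((|Real.log (coneMeasure.real (HubBulk (1 / 2)))| + |Real.log (coneConst ^ 3 / 64)| + 183620 * (L : ℝ) ^ 8) + 40) *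
              (L : ℝ) ^ (12 + k₂ + k₂ * k₂) * τ⁻¹ ^ k₂
          ≤ 40000 * (K₂ + 1) ^ (k₂ + 1) * ((A₀ + 183620 + 40) * (L : ℝ) ^ 8) * (L : ℝ) ^ (12 + k₂ + k₂ * k₂) * τ⁻¹ ^ dB := by
            refine mul_le_mul (mul_le_mul_of_nonneg_right (mul_le_mul_of_nonneg_left hin (by positivity)) (by positivity))
              (pow_le_pow_right₀ hτi1 (by omega)) (by positivity) (by positivity)
        _ = D₀ * (L : ℝ) ^ dB * τ⁻¹ ^ dB := by rw [hD₀, hdB]; ring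
    have h0 : 0 ≤ 40000 * (K₂ + 1) ^ (k₂ + 1) *
        ((|Real.log (coneMeasure.real (HubBulk (1 / 2)))| + |Real.log (coneConst ^ 3 / 64)| + 183620 * (L : ℝ) ^ 8) + 40) *
          (L : ℝ) ^ (12 + k₂ + k₂ * k₂) * τ⁻¹ ^ k₂ := by positivity
    calc _ ≤ (D₀ * (L : ℝ) ^ dB * τ⁻¹ ^ dB) ^ 4 := pow_le_pow_left₀ h0 h1 4
      _ = D₀ ^ 4 * (L : ℝ) ^ (4 * dB) * τ⁻¹ ^ (4 * dB) := by rw [mul_pow, mul_pow, ← pow_mul, ← pow_mul, mul_comm dB 4]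
  -- the tail threshold
  obtain ⟨hb1, hXT⟩ := endTail_threshold (L := L) hτ hτ1 hAT40 hbT
  have hb0 : 0 ≤ b := by linarith
  have hq0 : 0 ≤ b ^ (1 / 4 : ℝ) := Real.rpow_nonneg hb0 _
  have hX : b ^ (1 / 4 : ℝ) * (4 * (9 * (L : ℝ) ^ 4 + 1) +
      (|Real.log (coneMeasure.real (HubBulk (1 / 2)))| + 2 * |Real.log (coneConst ^ 3 / 64)| + 154 + 183629 * (L : ℝ) ^ 8)) ≤
      b * (τ ^ 4 / ((1 + τ ^ 2) * (1 + (1 : ℝ) ^ 2) ^ 2 * (15000 * (1 + (Fintype.card (Fol L) : ℝ)) * (L : ℝ) ^ 6))) :=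
    (mul_le_mul_of_nonneg_left (endTail_const_le (L := L) hL1) hq0).trans (by rw [← hAT]; exact hXT)
  have hκ : 0 ≤ stiffKappa L (1 / 8) := (stiffKappa_pos_le_exp (L := L)).1.le
  -- per sign pattern
  have hper : ∀ ε ∈ (Finset.univ.filter fun ε : GnoSign L => GoodSign ε),
      stiffKappa L (1 / 8) *
          ∫ x in (EndHub τ ×ˢ (univ : Set (GnoCoord L))) \ BTubeCap L τ 1, Real.exp (-(b * gnoDeficit z₀ (fun _ => 1) x.1 ε x.2)) ∂chartMeasure L ≤
        (1 / 32 : ℝ) * ∫ a in HubBulk τ, hubIntegral a ε b ∂coneMeasure := by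
    intro ε hεm
    have hε : GoodSign ε := (Finset.mem_filter.1 hεm).2
    have hsplit := mul_le_mul_of_nonneg_left (setIntegral_endCore_chart_le_gaussHalf_add_tail ε hτ hb0) hκ
    have hGε := hGf L τ hτ hτleG b hbG ε hε
    have hT := endTail_le_main (L := L) hε hτ hτ1 hb1 hX
    have hZ := bulkHub_ge_half_main hK₂ (hS2 L) hε hτ hτ1 hbB
    rw [mul_add, mul_add] at hsplit
    linarith
  calc stiffKappa L (1 / 8) * ∑ ε ∈ (Finset.univ.filter fun ε : GnoSign L => GoodSign ε),
        ∫ x in (EndHub τ ×ˢ (univ : Set (GnoCoord L))) \ BTubeCap L τ 1, Real.exp (-(b * gnoDeficit z₀ (fun _ => 1) x.1 ε x.2)) ∂chartMeasure L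
      = ∑ ε ∈ (Finset.univ.filter fun ε : GnoSign L => GoodSign ε), stiffKappa L (1 / 8) *
          ∫ x in (EndHub τ ×ˢ (univ : Set (GnoCoord L))) \ BTubeCap L τ 1, Real.exp (-(b * gnoDeficit z₀ (fun _ => 1) x.1 ε x.2)) ∂chartMeasure L :=
        Finset.mul_sum _ _ _
    _ ≤ ∑ ε ∈ (Finset.univ.filter fun ε : GnoSign L => GoodSign ε), (1 / 32 : ℝ) * ∫ a in HubBulk τ, hubIntegral a ε b ∂coneMeasure :=
        Finset.sum_le_sum hper
    _ = _ := (Finset.mul_sum _ _ _).symm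

end Summit.QuantumFields.YangMills.Theorems.SwapVirialDeficit.SectorLaplace

end
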